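import Summits.HodgeConjecture.HodgeConjecture.Theorems.R90S6TwistedHeckeFLValueComplex      -- PIN 3 (this seat): (X.1)∕(X.2)∕(X.3-ONE) in ★ `Ch4Sec10.epsOrbitalIntegral` currency; brings ★ C-PIN, ★ 2c, ★ 2a∕2b, ★ TJ1, ★ `Ch4Sec10`
import Literature.NumberTheory.Automorphic.SatakeParametersGLXiRecursion                     -- ★ `valuation_det_eq_zpow_sum_iwasawaExp` (`|det y| = |ϖ|^{Σ e(y)}`)
import Literature.NumberTheory.Automorphic.OrbitalMeasureCanonical                           -- ★ `compactCore`, `mem_compactCore_iff` (the socket's torus pin, ★ S4 `IsEpsCanonicalAt`)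
import Summits.HodgeConjecture.HodgeConjecture.Theorems.R90S6TwistedKappaClassFunction        -- ★ K4 (p04): `det_coe_qsInvolution` (`det Θ_σ(g) = σ(det g)⁻¹`) — REUSED, not restated
import HarnessLib

/-!
# R90 · S6 «Ch. 14.1–14.5 stable trace formula» — PIN 4: THE ε-TWISTED ORBITAL INTEGRAL OF `𝟙_{K̃ϖ^λK̃}` AT THE ε-CLASS — ★ TB2d A (A.2)'s `hTO` BINDER
# `classEpsOrbitalIntegral ε mt φ c₀ = J * S` SUPPLIED FROM A DIAGONAL ε-REGULAR REPRESENTATIVE (`Theorems/R90S6TwistedHyperbolicHeckeFLAtClass.lean`)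

Cell `hodgecm-mathlib`, crux H413 (`stmt-HodgeConjecture-24833`), route of record `HCCMUnconditional`; programme R90-TF (brief `director/R90-BRIEF.v2.md`), section S6
(base `R90-C14`), seat R90-C14-p06 (g2); dealer R90-C14-plan (g3) RULINGS #34 (R80) ∕ #38 (R89) 04:05–04:08Z («PIN 4 = the assembler: discharge ★ TB2d A (A.2)'s `hTO`
AT THE CLASS from (X.3-ONE) at a diagonal ε-regular representative `δ₀ ∈ c₀`, with the torus pin in the SOCKET's currency — compact-core mass one, ★ S4 `IsEpsCanonicalAt`
— and the representative step `hRep` stated as the bare equation, discharged at the CM carrier by ★ S4 `IsEpsCanonicalAt.classEpsOrbitalIntegral_mk_eq_epsOrbitalIntegral`»).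
Lane `--kind proof --supports stmt-HodgeConjecture-24833 --as helper`; THEOREMS ONLY (no definition ∕ instance ∕ notation ∕ named fact ∕ `sorry`); junction bytes of
★ TB2d A∕B∕C∕C-PIN, ★ PIN 3, ★ 2a∕2b∕2c, ★ S4 untouched.

## THE PRINT AND THE SOCKET
[Rogawski1990, §4.10 (4.10.1)–(4.10.2), Prop. 4.10.1 (a), Prop. 4.10.2 pp. 57–59; §4.3 (4.3.1) p. 43; §1.6–1.7 pp. 5–6].  ★ TB2d A (A.2)
`epsKappaOrbitalIntegral_one_eq_stableOrbitalIntegralRel_of_values` binds `hTO : classEpsOrbitalIntegral ε mt φ c₀ = J * S` (`J S : ℂ`), i.e. (★ `Ch4Sec10` :178, rfl)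
`epsOrbitalIntegral ε (out c₀) φ (mt c₀) = J * S`.  The socket's twisted family is ε-CANONICAL (★ S4 `IsEpsCanonicalAt`): at an ε-regular class the member is the
canonical quotient `νGt ∕ t` (★ `quotientMeasure`) by THE inversion-invariant Haar measure `t` of the ε-centraliser with **`t (compactCore) = 1`** («compatible measures»,
§4.3).  ★ PIN 3 (X.3-ONE) computes `epsOrbitalIntegral ε δ₀ 𝟙_{K̃ϖ^λK̃} (ν∕t)` at a DIAGONAL ε-regular `δ₀` under `ν(K̃) = 1`, `t(T_ε ∩ K̃) = 1`.  This file closes the gap: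
* §1 **`compactCore_eq_preimage_glInt_of_le_standardLeviGL`** (any `n`, any closed `T ≤ A = M_{id}`): `compactCore ↥T = T ∩ K̃` — a compact subgroup `C` of the split
  torus meets the open `K̃` in a subgroup of finite index (Mathlib `Subgroup.quotient_finite_of_isOpen`), so every `z ∈ C` has a power `zᵐ ∈ K̃` (`exists_pow_mem_of_index_ne_zero`),
  whence `|z_ii|ᵐ = 1` for every diagonal entry (`|det zᵐ| = 1`, entries integral) and `|z_ii| = 1`, i.e. `z ∈ K̃` (★ `diagonalGL_mem_glInt`); conversely `T ∩ K̃` is a compact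
  subgroup (`T` closed).  So the socket's pin `t (compactCore T_ε) = 1` IS (X.3-ONE)'s `t(T_ε ∩ K̃) = 1` at a diagonal ε-regular `δ₀`.
* §2 **`sum_iwasawaExp_mul_mul_qsInvolution_inv_eq`** (any `n`, `σ` isometric): `Σ e(h δ Θ(h)⁻¹) = Σ e(δ) + 2 Σ e(h)` (`|det y| = |ϖ|^{Σe(y)}` ★, ★ K4 `det_coe_qsInvolution`),
  hence **`even_sub_sum_iwasawaExp_twistedConj_iff`**: the parity letter `2 ∣ Σλ − Σ e(δ)` of ★ C-PIN ∕ PIN 3 is an ε-CLASS INVARIANT (the selection rule (4.10.1) does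
  not depend on the representative).
* §3 HEAD **`classEpsOrbitalIntegral_indicator_zpowDiagGL_eq_mul_natCast_of_rep`**: in ★ PIN 3's frame (X.3-ONE) VERBATIM but with the torus pin
  `(h1 : t (compactCore ↥(epsCentralizer ε δ)) = 1)` INSTEAD of `ht`, plus a twisted family `mt : EpsOrbitalMeasureFamily ε Z′`, a class `c₀` and the representative
  equation `hRep : ∀ φ : G̃ → ℂ, classEpsOrbitalIntegral ε mt φ c₀ = epsOrbitalIntegral ε δ φ (ν∕t)` (at the CM carrier: ★ S4 p863195 for every compact-core-normalised
  `t`; in general any (E.3)):  **`classEpsOrbitalIntegral ε mt 𝟙_{K̃ϖ^λK̃} c₀ = (J(δ) : ℂ) · (N_k(λ) : ℂ)`** under parity — LITERALLY ★ (A.2)'s `hTO` with `J := ↑J(δ)`,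
  `S := ↑N_k(λ)` (★ (B.4) reads `S`); and the off-parity twin **`…_eq_zero_of_rep_of_not_even`**: `= 0`.

HONEST LABEL: the carrier junction `K = L_w` (identifying `GL (Fin 3) K`, `Θ_σ` with ★ S4's `GtLoc L v`, `epsLoc L Φ v`) and the name of the unit-Haar letter
`hν : νGt K̃ = 1` are the socket's (G5 ∕ D ED. 6; p01 (g3)'s measure-pin memo); `α`, `t′` stay auxiliary hypotheses (★ CanonicalOne convention); `hRep` is a
binder here, ★ at the CM carrier.  Count-neutral; discharges no named input.  HC_CM is proved only modulo the 7 printed citations (2 remaining named inputs: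
hLiu418 = `stmt-HodgeConjecture-24832`, h413 = `stmt-HodgeConjecture-24833`) until rung 0 closes; REL ≠ ★ ≠ BUILT.

## Tree search
★ `OrbitalMeasureCanonical.{compactCore, mem_compactCore_iff}`; ★ S4 `R90S4EpsOrbitalCanonical.IsEpsCanonicalAt` (:83, the pin), ★ S4 `IsEpsCanonicalAt.classEpsOrbitalIntegral_mk_eq_epsOrbitalIntegral`
(p863195, the CM-carrier `hRep`), ★ `R90S4EpsCentralizerMeasureTransport.map_apply_compactCore`; ★ `valuation_det_eq_zpow_sum_iwasawaExp`, `valuation_det_eq_one_of_mem_glInt`,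
`mem_glInt_iff`, `diagonalGL_mem_glInt`, `isOpen_glInt`, `isCompact_glInt`, `mem_standardLeviGL_iff`, ★ K4 `det_coe_qsInvolution` (REUSED by import — dedup),
`valuation_map_of_continuous_involution` (★ 2a); Mathlib `Subgroup.quotient_finite_of_isOpen`, `Subgroup.exists_pow_mem_of_index_ne_zero`, `zpow_right_strictAnti₀`,
`Matrix.det_nonsing_inv`, `RingHom.map_det`.  Dedup: `rg "compactCore_eq_preimage_glInt|sum_iwasawaExp_mul_mul_qsInvolution|_of_rep"` over Summits∕Literature — no hit.

## References
* [Rogawski1990] J. D. Rogawski, *Automorphic Representations of Unitary Groups in Three Variables*, Ann. of Math. Stud. 123 (1990), §1.6–1.7 pp. 5–6, §4.3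
  (4.3.1) p. 43, §4.10 (4.10.1)–(4.10.2), Prop. 4.10.2 pp. 57–59.
* [Kottwitz1986BaseChangeUnits] R. Kottwitz, *Base change for unit elements of Hecke algebras*, Compositio Math. 60 (1986), §3.
* [DeitmarEchterhoff2014] A. Deitmar, S. Echterhoff, *Principles of Harmonic Analysis*, 2nd ed. (2014), Thm. 1.5.3.
* [BourbakiGT1] N. Bourbaki, *General Topology*, Ch. III §2 (compact subgroups), §4.6.
-/

set_option autoImplicit false
-- the mandated namespace repeats the single-problem summit's segment (`HodgeConjecture.HodgeConjecture`)
set_option linter.dupNamespace false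

noncomputable section

open MeasureTheory Measure Set Function Filter Topology
open scoped ENNReal NNReal Pointwise MatrixGroups
open ValuativeRel MulAction Finset
open Literature.NumberTheory.Automorphic Literature.MeasureTheory.Group Literature.NumberTheory.Rogawski1990.Ch4Sec10
open Literature.NumberTheory.GaloisRepresentations Literature.NumberTheory.GaloisRepresentations.IsNonarchimedeanLocalField
open Literature.NumberTheory.Automorphic.heckeAlgebra

namespace Summit.HodgeConjecture.HodgeConjecture.R90.S6

/-! ## §1 The compact core of a closed subgroup of the split torus is its intersection with `K̃` -/

section CompactCore

variable {K : Type*} [Field K] [ValuativeRel K] {n : ℕ}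

omit [ValuativeRel K] in
/-- an element of the diagonal torus has a diagonal matrix (any `n`). [folklore] -/
private theorem coe_eq_diagonal_of_mem_standardLeviGL_id {a : GL (Fin n) K} (ha : a ∈ standardLeviGL K (_root_.id : Fin n → Fin n)) :
    (a : Matrix (Fin n) (Fin n) K) = Matrix.diagonal fun i => (a : Matrix (Fin n) (Fin n) K) i i := by
  ext i j
  by_cases hij : i = j
  · subst hij; rw [Matrix.diagonal_apply_eq]
  · rw [Matrix.diagonal_apply_ne _ hij]
    exact (mem_standardLeviGL_iff (_root_.id : Fin n → Fin n) a).1 ha i j hij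

/-- a `GLₙ` element with a diagonal matrix of UNIT entries lies in `K̃ = GLₙ(𝒪)` (★ `diagonalGL_mem_glInt`). [folklore] -/
private theorem mem_glInt_of_coe_eq_diagonal_of_valuation_eq_one {g : GL (Fin n) K} {y : Fin n → K}
    (hg : (g : Matrix (Fin n) (Fin n) K) = Matrix.diagonal y) (hy : ∀ i, valuation K (y i) = 1) : g ∈ glInt n K := by
  have hy0 : ∀ i, y i ≠ 0 := fun i h => by have := hy i; rw [h, map_zero] at this; exact zero_ne_one this
  have hgd : g = diagonalGL (Fin n) K (fun i => Units.mk0 (y i) (hy0 i)) := by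
    apply Units.ext
    simp only [hg, coe_diagonalGL, Units.val_mk0]
  rw [hgd]
  exact diagonalGL_mem_glInt (fun i => hy i)

variable [TopologicalSpace K] [IsNonarchimedeanLocalField K]

/-- **THE COMPACT CORE OF A CLOSED SUBGROUP OF THE SPLIT TORUS IS ITS INTERSECTION WITH `K̃`.**  For a closed subgroup `T ≤ A = M_{id}` (diagonal) of `GLₙ(K)`:
`compactCore ↥T = {z ∈ T : z ∈ GLₙ(𝒪)}`.  (`⊇`: `T ∩ K̃` is a compact subgroup, `T` closed, `K̃` compact open.  `⊆`: a compact subgroup `C ∋ z` meets the open `K̃` in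
an open subgroup of finite index, so `zᵐ ∈ K̃` for some `m ≥ 1`; `z` is diagonal, `|det zᵐ| = 1` with integral entries forces `|z_ii|ᵐ = 1`, hence `|z_ii| = 1` for all
`i` — the split torus' unique maximal compact subgroup.)  So ★ S4 `IsEpsCanonicalAt`'s pin `t (compactCore T_ε) = 1` is `t (T_ε ∩ K̃) = 1` at a diagonal ε-regular
point (§4.3 «compatible measures», `vol(T ∩ K̃) = 1`). [cite: Rogawski1990, §4.3 (4.3.1) p. 43; §1.7 p. 6] [cite: BourbakiGT1, Ch. III §4.6] -/
theorem compactCore_eq_preimage_glInt_of_le_standardLeviGL {T : Subgroup (GL (Fin n) K)}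
    (hTA : T ≤ standardLeviGL K (_root_.id : Fin n → Fin n)) (hT : IsClosed (T : Set (GL (Fin n) K))) :
    compactCore ↥T = Subtype.val ⁻¹' (glInt n K : Set (GL (Fin n) K)) := by
  ext z
  rw [mem_compactCore_iff, Set.mem_preimage, SetLike.mem_coe]
  constructor
  · rintro ⟨C, hC, hzC⟩
    haveI : CompactSpace ↥C := isCompact_iff_compactSpace.1 hC
    set U : Subgroup ↥C := (glInt n K).comap (T.subtype.comp C.subtype) with hU
    have hUo : IsOpen (U : Set ↥C) := by
      rw [hU, Subgroup.coe_comap]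
      exact (isOpen_glInt n K).preimage (continuous_subtype_val.comp continuous_subtype_val)
    haveI : Finite (↥C ⧸ U) := Subgroup.quotient_finite_of_isOpen U hUo
    obtain ⟨m, hm0, -, hm⟩ := U.exists_pow_mem_of_index_ne_zero U.index_ne_zero_of_finite ⟨z, hzC⟩
    have hzm : (z : GL (Fin n) K) ^ m ∈ glInt n K := by
      have := Subgroup.mem_comap.1 hm
      simpa using this
    -- `z` is diagonal with non-zero entries `y`
    set y : Fin n → K := fun i => ((z : GL (Fin n) K) : Matrix (Fin n) (Fin n) K) i i with hy
    have hdiag : ((z : GL (Fin n) K) : Matrix (Fin n) (Fin n) K) = Matrix.diagonal y :=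
      coe_eq_diagonal_of_mem_standardLeviGL_id (hTA z.2)
    have hpow : (((z : GL (Fin n) K) ^ m : GL (Fin n) K) : Matrix (Fin n) (Fin n) K) = Matrix.diagonal (y ^ m) := by
      rw [Units.val_pow_eq_pow_val, hdiag, Matrix.diagonal_pow]
    -- every `|y i|^m ≤ 1` and their product is `|det z^m| = 1`
    have hle : ∀ i, valuation K (y i) ^ m ≤ 1 := fun i => by
      have := ((mem_glInt_iff _).1 hzm).1 i i
      rw [hpow, Matrix.diagonal_apply_eq, Pi.pow_apply] at this
      rw [← map_pow]
      exact (Valuation.mem_integer_iff _ _).1 this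
    have hprod : ∏ i, valuation K (y i) ^ m = 1 := by
      have h := valuation_det_eq_one_of_mem_glInt hzm
      rw [hpow, Matrix.det_diagonal, map_prod] at h
      simpa only [Pi.pow_apply, map_pow] using h
    have hone : ∀ i, valuation K (y i) ^ m = 1 := fun i =>
      (Finset.prod_eq_one_iff_of_le_one' fun j _ => hle j).1 hprod i (Finset.mem_univ i)
    refine mem_glInt_of_coe_eq_diagonal_of_valuation_eq_one hdiag fun i => ?_
    rcases lt_trichotomy (valuation K (y i)) 1 with hlt | heq | hgt
    · exact absurd (hone i) (pow_lt_one₀ zero_le hlt hm0.ne').ne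
    · exact heq
    · exact absurd (hone i) (one_lt_pow₀ hgt hm0.ne').ne'
  · intro hz
    refine ⟨(glInt n K).comap T.subtype, ?_, Subgroup.mem_comap.2 hz⟩
    rw [Subgroup.coe_comap]
    exact hT.isClosedEmbedding_subtypeVal.isCompact_preimage (isCompact_glInt n K)

end CompactCore

/-! ## §2 The parity letter `2 ∣ Σλ − Σ e(δ)` is an ε-class invariant -/

section Parity

variable {K : Type*} [Field K] [ValuativeRel K] [IsDiscreteValuationRing 𝒪[K]] {ϖ : K} (hϖ : IsUniformizingElement ϖ) {n : ℕ}
  (σ : K →+* K) (hvσ : ∀ x, valuation K (σ x) = valuation K x)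

include hvσ in
/-- **`Σ_i e(h δ Θ_σ(h)⁻¹)_i = Σ_i e(δ)_i + 2 Σ_i e(h)_i`** for an isometric `σ` (`|det y| = |ϖ|^{Σ e(y)}` ★ `valuation_det_eq_zpow_sum_iwasawaExp`, `det Θ_σ(h) = σ(det h)⁻¹` ★ K4 `det_coe_qsInvolution`,
`|σ x| = |x|`). [cite: Rogawski1990, §4.10 (4.10.1) p. 57] [cite: Kottwitz1986BaseChangeUnits, §3] -/
theorem sum_iwasawaExp_mul_mul_qsInvolution_inv_eq (h δ : GL (Fin n) K) :
    ∑ i, iwasawaExp hϖ (h * δ * (UnitaryGroup.qsInvolution σ h)⁻¹) i = ∑ i, iwasawaExp hϖ δ i + 2 * ∑ i, iwasawaExp hϖ h i := by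
  have hv0 : valuation K ϖ ≠ 0 := (map_ne_zero (valuation K)).2 hϖ.ne_zero
  have hinj : Function.Injective fun k : ℤ => valuation K ϖ ^ k :=
    (zpow_right_strictAnti₀ (zero_lt_iff.2 hv0) hϖ.valuation_lt_one).injective
  apply hinj
  have hdeth : valuation K ((h : Matrix (Fin n) (Fin n) K).det) ≠ 0 :=
    (map_ne_zero (valuation K)).2 (by rw [← Matrix.GeneralLinearGroup.val_det_apply]; exact (Matrix.GeneralLinearGroup.det h).ne_zero)
  have hΘ : valuation K (((UnitaryGroup.qsInvolution σ h : GL (Fin n) K) : Matrix (Fin n) (Fin n) K).det) =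
      (valuation K ((h : Matrix (Fin n) (Fin n) K).det))⁻¹ := by
    rw [det_coe_qsInvolution h, map_inv₀, hvσ]
  simp only
  rw [← valuation_det_eq_zpow_sum_iwasawaExp hϖ, zpow_add₀ hv0, ← valuation_det_eq_zpow_sum_iwasawaExp hϖ, mul_comm (2 : ℤ), zpow_mul,
    ← valuation_det_eq_zpow_sum_iwasawaExp hϖ, Units.val_mul, Units.val_mul, Matrix.det_mul, Matrix.det_mul, map_mul, map_mul,
    Matrix.coe_units_inv, Matrix.det_nonsing_inv, Ring.inverse_eq_inv', map_inv₀, hΘ, inv_inv, zpow_two, mul_right_comm, mul_comm]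

include hvσ in
/-- **THE PARITY LETTER IS AN ε-CLASS INVARIANT**: `2 ∣ Σλ − Σ e(h δ Θ_σ(h)⁻¹) ↔ 2 ∣ Σλ − Σ e(δ)` — the selection rule of (4.10.1) (★ C-PIN (C.2), ★ PIN 3 (X.2)) does
not depend on the representative of the ε-class. [cite: Rogawski1990, §4.10 (4.10.1) p. 57; §3.11 p. 35] [cite: Kottwitz1986BaseChangeUnits, §3] -/
theorem even_sub_sum_iwasawaExp_twistedConj_iff (h δ : GL (Fin n) K) (s : ℤ) :
    2 ∣ s - ∑ i, iwasawaExp hϖ (h * δ * (UnitaryGroup.qsInvolution σ h)⁻¹) i ↔ 2 ∣ s - ∑ i, iwasawaExp hϖ δ i := by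
  rw [sum_iwasawaExp_mul_mul_qsInvolution_inv_eq hϖ σ hvσ h δ,
    show s - (∑ i, iwasawaExp hϖ δ i + 2 * ∑ i, iwasawaExp hϖ h i) = (s - ∑ i, iwasawaExp hϖ δ i) + 2 * (-∑ i, iwasawaExp hϖ h i) by ring,
    Int.dvd_add_left (dvd_mul_right 2 _)]

end Parity

/-! ## §3 ★ TB2d A (A.2)'s `hTO` at the ε-class, from a diagonal ε-regular representative -/

section AtClass

-- the frame of ★ PIN 3 (X.3-ONE), with the FAMILY of quotient σ-algebras of ★ `Ch4Sec10.classEpsOrbitalIntegral`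
variable {K : Type*} [Field K] [ValuativeRel K] [TopologicalSpace K] [IsNonarchimedeanLocalField K] [MeasurableSpace K] [BorelSpace K]
  [IsDiscreteValuationRing 𝒪[K]] {ϖ : K} (hϖ : IsUniformizingElement ϖ)
  [MeasurableSpace (GL (Fin 3) K)] [BorelSpace (GL (Fin 3) K)]
  (σ : K →+* K) (hσ : ∀ x, σ (σ x) = x) (hσc : Continuous σ)
  (ε : GL (Fin 3) K →* GL (Fin 3) K) (hε : Continuous ε) (hεΘ : ∀ g, ε g = UnitaryGroup.qsInvolution σ g)
  (hεK : ∀ k ∈ glInt 3 K, ε k ∈ glInt 3 K)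
  (δ : GL (Fin 3) K) (d : Fin 3 → K) (hδ : (δ : Matrix (Fin 3) (Fin 3) K) = Matrix.diagonal d)
  [∀ δ' : GL (Fin 3) K, MeasurableSpace (GL (Fin 3) K ⧸ epsCentralizer ε δ')] [∀ δ' : GL (Fin 3) K, BorelSpace (GL (Fin 3) K ⧸ epsCentralizer ε δ')]

include hϖ hσ hσc hε hεΘ hεK hδ in
/-- **(P4) ★ TB2d A (A.2)'s `hTO` AT THE ε-CLASS.**  In ★ PIN 3's frame (X.3-ONE) (`ε = Θ_σ`, `ε K̃ ⊆ K̃`, `δ = diag(d)` ε-regular `ha hb`, `T = G̃_{δε} ≤ A = M_{id}`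
closed, `ν` Haar on `GL₃(K)` right invariant with `ν(K̃) = 1`, `t` Haar on `T` inversion invariant, `α`, `t′` auxiliary), with the torus pin in the SOCKET's currency
**`h1 : t (compactCore ↥G̃_{δε}) = 1`** (★ S4 `IsEpsCanonicalAt`; = `t(T ∩ K̃) = 1` by §1), a twisted family `mt` (classes modulo `Z′`), an ε-class `c₀` and the
representative equation `hRep : ∀ φ, classEpsOrbitalIntegral ε mt φ c₀ = epsOrbitalIntegral ε δ φ (ν∕t)` (at the CM carrier: ★ S4
`IsEpsCanonicalAt.classEpsOrbitalIntegral_mk_eq_epsOrbitalIntegral`), for every `λ` with `Σλ ≡ Σ e(δ) (mod 2)`: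
**`classEpsOrbitalIntegral ε mt 𝟙_{K̃ϖ^λK̃} c₀ = (J(δ) : ℂ) · (N_k(λ) : ℂ)`**, `J(δ) = (‖d₂∕d₁·σ(d₁∕d₀) − 1‖ · √‖1 − d₂∕d₀·σ(d₂∕d₀)‖)⁻¹` (★ TJ1),
`N_k(λ) = Σ_{μ ∈ e(O_λ), μ₀−μ₂ = e(δ)₀−e(δ)₂} #{γ ∈ O_λ : e γ = μ}` — LITERALLY the `hTO : classEpsOrbitalIntegral ε mt φ c₀ = J * S` binder of ★ (A.2) with `S := ↑N_k(λ)`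
(read by ★ (B.4) as `u^{2k}·(𝒮_w(b c_λ))_{ℓ_k}`). [cite: Rogawski1990, §4.10 Prop. 4.10.1 (a), Prop. 4.10.2 pp. 58–59; §4.3 (4.3.1) p. 43] [cite: Kottwitz1986BaseChangeUnits, §3] -/
theorem classEpsOrbitalIntegral_indicator_zpowDiagGL_eq_mul_natCast_of_rep (hσ1 : ∃ x, σ x ≠ x)
    [T2Space (GL (Fin 3) K)] [SecondCountableTopology (GL (Fin 3) K)] [LocallyCompactSpace (GL (Fin 3) K)]
    [IsHeckeTriple (⊤ : Submonoid (GL (Fin 3) K)) (glInt 3 K) (glInt 3 K)]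
    (ha : d 2 / d 1 * σ (d 1 / d 0) - 1 ≠ 0) (hb : 1 - d 2 / d 0 * σ (d 2 / d 0) ≠ 0)
    {A : Subgroup (GL (Fin 3) K)} (hAid : A = standardLeviGL K (_root_.id : Fin 3 → Fin 3)) (hA : IsClosed (A : Set (GL (Fin 3) K)))
    (hT : IsClosed (epsCentralizer ε δ : Set (GL (Fin 3) K))) (hTA : epsCentralizer ε δ ≤ A)
    [MeasurableSpace (GL (Fin 3) K ⧸ A)] [BorelSpace (GL (Fin 3) K ⧸ A)]
    [MeasurableSpace (↥A ⧸ (epsCentralizer ε δ).subgroupOf A)] [BorelSpace (↥A ⧸ (epsCentralizer ε δ).subgroupOf A)]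
    (ν : Measure (GL (Fin 3) K)) [IsHaarMeasure ν] [ν.IsMulRightInvariant]
    (α : Measure ↥A) [IsHaarMeasure α] [α.IsMulRightInvariant] [α.IsInvInvariant]
    (t : Measure ↥(epsCentralizer ε δ)) [IsHaarMeasure t] [t.IsInvInvariant]
    (t' : Measure ↥((epsCentralizer ε δ).subgroupOf A)) [IsHaarMeasure t'] [t'.IsInvInvariant]
    (ht' : t' = Measure.map (Subgroup.subgroupOfEquivOfLe hTA).symm t)
    (hν : ν (glInt 3 K : Set (GL (Fin 3) K)) = 1) (h1 : t (compactCore ↥(epsCentralizer ε δ)) = 1)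
    {Z' : Subgroup (GL (Fin 3) K)} (mt : EpsOrbitalMeasureFamily ε Z') (c₀ : EpsConjClassesMod ε Z')
    (hRep : ∀ φ : GL (Fin 3) K → ℂ, classEpsOrbitalIntegral ε mt φ c₀ = epsOrbitalIntegral ε δ φ (quotientMeasure (epsCentralizer ε δ) t hT ν))
    {lam : Fin 3 → ℤ} (hpar : 2 ∣ ∑ i, lam i - ∑ i, iwasawaExp hϖ δ i) :
    classEpsOrbitalIntegral ε mt
        (((glInt 3 K : Set (GL (Fin 3) K)) * {zpowDiagGL hϖ.ne_zero lam} * (glInt 3 K : Set (GL (Fin 3) K))).indicator (1 : GL (Fin 3) K → ℂ)) c₀ =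
      ((((normAbs K (d 2 / d 1 * σ (d 1 / d 0) - 1))⁻¹ * (NNReal.sqrt (normAbs K (1 - d 2 / d 0 * σ (d 2 / d 0))))⁻¹ : ℝ≥0) : ℝ) : ℂ) *
        ((∑ μ ∈ ((finite_orbit_quotient (glInt 3 K) (zpowDiagGL hϖ.ne_zero lam)).toFinset.image fun γ => iwasawaExp hϖ γ.out) with
              μ 0 - μ 2 = iwasawaExp hϖ δ 0 - iwasawaExp hϖ δ 2,
            ((finite_orbit_quotient (glInt 3 K) (zpowDiagGL hϖ.ne_zero lam)).toFinset.filter fun γ => iwasawaExp hϖ γ.out = μ).card : ℕ) : ℂ) := by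
  have ht : t (Subtype.val ⁻¹' (glInt 3 K : Set (GL (Fin 3) K))) = 1 := by
    rwa [compactCore_eq_preimage_glInt_of_le_standardLeviGL (hAid ▸ hTA) hT] at h1
  rw [hRep]
  exact epsOrbitalIntegral_indicator_zpowDiagGL_quotientMeasure_eq_mul_natCast_of_measure_eq_one hϖ σ hσ hσc ε hε hεΘ hεK δ d hδ hσ1 ha hb hAid hA
    hT hTA ν α t t' ht' hν ht hpar

include hϖ hσ hσc hε hεΘ hεK hδ in
/-- **(P4′) THE SELECTION RULE AT THE ε-CLASS**: under the same binders, if `Σλ ≢ Σ e(δ) (mod 2)` then `classEpsOrbitalIntegral ε mt 𝟙_{K̃ϖ^λK̃} c₀ = 0` (★ PIN 3 (X.2)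
through `hRep`; by §2 the parity condition is an invariant of the ε-class). [cite: Rogawski1990, §4.10 (4.10.1) p. 57; §3.11 p. 35] [cite: Kottwitz1986BaseChangeUnits, §3] -/
theorem classEpsOrbitalIntegral_indicator_zpowDiagGL_eq_zero_of_rep_of_not_even (hσ1 : ∃ x, σ x ≠ x)
    [T2Space (GL (Fin 3) K)] [SecondCountableTopology (GL (Fin 3) K)] [LocallyCompactSpace (GL (Fin 3) K)]
    [IsHeckeTriple (⊤ : Submonoid (GL (Fin 3) K)) (glInt 3 K) (glInt 3 K)]
    (ha : d 2 / d 1 * σ (d 1 / d 0) - 1 ≠ 0) (hb : 1 - d 2 / d 0 * σ (d 2 / d 0) ≠ 0)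
    {A : Subgroup (GL (Fin 3) K)} (hAid : A = standardLeviGL K (_root_.id : Fin 3 → Fin 3)) (hA : IsClosed (A : Set (GL (Fin 3) K)))
    (hT : IsClosed (epsCentralizer ε δ : Set (GL (Fin 3) K))) (hTA : epsCentralizer ε δ ≤ A)
    [MeasurableSpace (GL (Fin 3) K ⧸ A)] [BorelSpace (GL (Fin 3) K ⧸ A)]
    [MeasurableSpace (↥A ⧸ (epsCentralizer ε δ).subgroupOf A)] [BorelSpace (↥A ⧸ (epsCentralizer ε δ).subgroupOf A)]
    (ν : Measure (GL (Fin 3) K)) [IsHaarMeasure ν] [ν.IsMulRightInvariant]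
    (α : Measure ↥A) [IsHaarMeasure α] [α.IsMulRightInvariant] [α.IsInvInvariant]
    (t : Measure ↥(epsCentralizer ε δ)) [IsHaarMeasure t] [t.IsInvInvariant]
    (t' : Measure ↥((epsCentralizer ε δ).subgroupOf A)) [IsHaarMeasure t'] [t'.IsInvInvariant]
    (ht' : t' = Measure.map (Subgroup.subgroupOfEquivOfLe hTA).symm t)
    {Z' : Subgroup (GL (Fin 3) K)} (mt : EpsOrbitalMeasureFamily ε Z') (c₀ : EpsConjClassesMod ε Z')
    (hRep : ∀ φ : GL (Fin 3) K → ℂ, classEpsOrbitalIntegral ε mt φ c₀ = epsOrbitalIntegral ε δ φ (quotientMeasure (epsCentralizer ε δ) t hT ν))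
    {lam : Fin 3 → ℤ} (hpar : ¬ 2 ∣ ∑ i, lam i - ∑ i, iwasawaExp hϖ δ i) :
    classEpsOrbitalIntegral ε mt
        (((glInt 3 K : Set (GL (Fin 3) K)) * {zpowDiagGL hϖ.ne_zero lam} * (glInt 3 K : Set (GL (Fin 3) K))).indicator (1 : GL (Fin 3) K → ℂ)) c₀ = 0 := by
  rw [hRep]
  exact epsOrbitalIntegral_indicator_zpowDiagGL_quotientMeasure_eq_zero_of_not_even hϖ σ hσ hσc ε hε hεΘ hεK δ d hδ hσ1 ha hb hAid hA hT hTA ν α t t' ht' hpar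

end AtClass

end Summit.HodgeConjecture.HodgeConjecture.R90.S6

end
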